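import Summits.HodgeConjecture.CorCM.Census.CyclicPrimeFacesGenerate

/-!
# Faces generate the Hodge lattice of the cyclic slice of prime degree, III: transport to the model of record — b17's
# `cyclicPrime_law` is an equality, attained by `(2^{p−1} − 1)/p` rank-four face classes, for every odd prime `p`

COR-CM (cell `pub-hodgecm2`), count-neutral kernel census by the binder seat b09 (gen 25; lane CYCLIC-PRIME-FACES, part V of
`CyclicPrimeTypeModel` → `CyclicPrimeTypeSquares` → `CyclicPrimeFacesDescent` → `CyclicPrimeFacesGenerate` → `CyclicPrimeFacesSlice`).
Bookkeeping definitions + theorems; no `decide` table, no certificate, no named fact, no geometry, no `sorry`.  HC_CM is not proved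
anywhere in this cell; nothing here is a headline and nothing here produces a period.

THE BRIDGE.  b17's model of record of the full slice of `(ℤ/2p, p)` (`Census/OddDegreeParityLawCyclicPrime.lean` §4): blocks
`Option (Orbits p)` (`none = E`, `some ω` = the primitive `p`-fold of the orbit `ω`), label groups `AbO`, `πO`, types `φO` (a CHOSEN
representative `Quotient.out ω` per orbit), labels `Pt (AbO p) = Σ b, ℤ/2 × A_b`, `hodgeVec`, `hodgeLattice (πO p) (φO p)`, `pairs`,
`transl`.  The map «label ↦ its type» `toTy : Pt (AbO p) → Ty p` — `(E, a) ↦` the constant type `a`, `(ω, a, y) ↦ tw (a, y) (out ω)` —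
is a BIJECTION (`toTyEquiv`; injectivity = b17's freeness `vadd_eq_self_iff`, surjectivity = every type is constant or a twist of
the representative of its orbit) which matches Pohlmann coefficients (`hodgeVec_eq_coef`), the action (`toTy_act`), conjugation
(`toTy_conj`), hence the Hodge lattices (`mem_hodgeLattice_iff`), the pairs and the translates (`pull_pairVec`, `pull_transl`) of
the representative-free model of parts I–IV.  So the choice of representatives in `φO` is immaterial, as b17's docstring says.

THE THEOREM OF RECORD (**`cyclicPrime_faces`**, **`cyclicPrime_law_eq`**).  For every odd prime `p` there is a family `S` of
`(2^p − 2)/(2p) = (2^{p−1} − 1)/p` vectors of b17's model, each a FACE CLASS (`faceClassO φ i j`: the indicator of the four labels whose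
types are the corners `φ, φ̄^{(i)}, φ̄^{(j)}, φ^{(ij)}` of a rank-four face `(φ; i, j)`, `i ≠ j` — the `1`-eigencomponent of its Weil
line; its Galois translates are the other eigencomponents), with
`hodgeLattice (πO p) (φO p) ≤ pairs ⊔ ℤ⟨transl (πO p) g t : g ∈ G, t ∈ S⟩` — and by b17's `cyclicPrime_law` no family of fewer vectors
of any kind does it.  Dictionary reading (lane 2 of the cell, «what is open by type»): for a cyclic CM field `F` of degree `2p`,
`p` prime (`F ⊂ ℚ(ζ_q)` for `q ≡ 1 (2p)`, `ℚ(ζ_q)` itself for `q = 2p + 1` prime, …), the Hodge ring of the whole slice of `F` — `E`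
and the `(2^{p−1} − 1)/p` simple CM `p`-folds with CM by `F` — modulo divisor classes is generated by the Galois conjugates of
EXACTLY `(2^{p−1} − 1)/p` classes, and rank-four FACE classes achieve it: `1, 3, 9, 93, 315, 3855, 13797` for
`2p = 6, 10, 14, 22, 26, 34, 38`; so that many non-vanishing face periods for `F` (one per listed face orbit) would give, via the
cell's face-transport files, the Hodge conjecture for every abelian variety dominated by products of CM abelian varieties with CM
inside `F` — uniformly in `p`, where the tree had certificates at `2p = 6, 10, 14` only.  Nothing here computes a period.
All [folklore].

## References
* [Pohlmann1968] H. Pohlmann, Algebraic cycles on abelian varieties of complex multiplication type, Ann. of Math. 88 (1968), Thm 1.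
* [Milne1999] J. S. Milne, Lefschetz motives and the Tate conjecture, Compositio Math. 117 (1999), Prop. 2.1, p. 54.
* [Weil1977HodgeRing] A. Weil, Abelian varieties and the Hodge ring, Œuvres Scientifiques III, [1977c], 421–429.
-/

namespace Summit.HodgeConjecture.CorCM.Census.CyclicPrimeFacesSlice

open Finset
open Summit.HodgeConjecture.CorCM.Census.CyclicPrimeTypeModel
open Summit.HodgeConjecture.CorCM.Census.CyclicPrimeTypeSquares
open Summit.HodgeConjecture.CorCM.Census.CyclicPrimeFacesDescent
open Summit.HodgeConjecture.CorCM.Census.CyclicPrimeFacesGenerate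
open Summit.HodgeConjecture.CorCM.Census.OddDegreeParityLaw (Pt AbO πO φO Orbits Nonconst act conj hodgeVec hodgeLattice)

variable (p : ℕ) [hp : Fact p.Prime]

/-! ## §1 The bijection «label ↦ type» -/

/-- The type carried by a label of b17's model: `(E, a) ↦` the constant type `a`; `(ω, a, y) ↦ tw (a, y) (out ω)`. [folklore] -/
noncomputable def toTy : Pt (AbO p) → Ty p
  | ⟨none, q⟩ => fun _ => q.1
  | ⟨some ω, q⟩ => tw p (q.1, q.2) (Quotient.out ω).1

/-- Two `±1`-valued indicators of equivalent conditions agree. [folklore] -/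
theorem ite_congr_iff {P Q : Prop} [Decidable P] [Decidable Q] (h : P ↔ Q) :
    (if P then (1 : ℤ) else -1) = if Q then 1 else -1 := by
  by_cases hq : Q
  · rw [if_pos hq, if_pos (h.mpr hq)]
  · rw [if_neg hq, if_neg (fun h' => hq (h.mp h'))]

/-- **Pohlmann coefficients match**: b17's `hodgeVec g x` is the coefficient of `g` at the type of `x`. [folklore] -/
theorem hodgeVec_eq_coef (g : ZMod 2 × ZMod p) (x : Pt (AbO p)) : hodgeVec (πO p) (φO p) g x = coef p g (toTy p x) := by
  have key1 : ∀ a b : ZMod 2, a + b = 0 ↔ a = b := by decide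
  have key2 : ∀ a b u : ZMod 2, a + b = u ↔ u + a = b := by decide
  obtain ⟨_ | ω, a, y⟩ := x
  · unfold hodgeVec coef
    refine ite_congr_iff ?_
    simp only [OddDegreeParityLaw.inPhi, act, OddDegreeParityLaw.φO, toTy, decide_eq_true_eq]
    exact key1 a g.1
  · unfold hodgeVec coef
    refine ite_congr_iff ?_
    simp only [OddDegreeParityLaw.inPhi, act, OddDegreeParityLaw.φO, OddDegreeParityLaw.πO, toTy, tw, decide_eq_true_eq]
    rw [add_comm g.2]
    exact key2 a g.1 _

/-- The type map intertwines b17's action on labels with the twist. [folklore] -/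
theorem toTy_act (g : ZMod 2 × ZMod p) (x : Pt (AbO p)) : toTy p (act (πO p) g x) = tw p g (toTy p x) := by
  obtain ⟨_ | ω, a, y⟩ := x
  · funext s
    simp [act, toTy, tw]
  · show tw p (a + g.1, y + (πO p (some ω)) g.2) (Quotient.out ω).1 = tw p g (tw p (a, y) (Quotient.out ω).1)
    rw [tw_tw]
    rfl

/-- The type map sends conjugate labels to conjugate types. [folklore] -/
theorem toTy_conj (x : Pt (AbO p)) : toTy p (conj x) = toTy p x + 1 := by
  obtain ⟨_ | ω, a, y⟩ := x
  · funext s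
    simp [conj, toTy]
  · show tw p (a + 1, y) (Quotient.out ω).1 = tw p (a, y) (Quotient.out ω).1 + 1
    funext s
    simp only [tw, Pi.add_apply, Pi.one_apply]
    ring

/-- On a primitive block the type map is b17's action: `toTy (ω, a, y) = ((a, −y) +ᵥ out ω).1`. [folklore] -/
theorem toTy_some (ω : Orbits p) (a : ZMod 2) (y : ZMod p) :
    toTy p ⟨some ω, (a, y)⟩ = (((a, -y) : ZMod 2 × ZMod p) +ᵥ Quotient.out ω).1 := by
  rw [vadd_val_eq_tw, neg_neg]
  rfl

/-- **The type map is injective** (b17's freeness of the action on nonconstant types). [folklore] -/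
theorem toTy_injective (hp2 : p ≠ 2) : Function.Injective (toTy p) := by
  intro x x' h
  obtain ⟨_ | ω, a, y⟩ := x <;> obtain ⟨_ | ω', a', y'⟩ := x'
  · -- E / E
    change PUnit at y; change PUnit at y'
    have ha : a = a' := by simpa [toTy] using congrFun h 0
    subst ha
    cases y; cases y'; rfl
  · -- E / primitive: a constant type is not a twist of a nonconstant one
    change ZMod p at y'
    exfalso
    apply (((a', -y') : ZMod 2 × ZMod p) +ᵥ Quotient.out ω').2
    intro s
    have h1 := congrFun h s
    have h0 := congrFun h 0
    rw [toTy_some] at h1 h0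
    have e1 : toTy p ⟨none, (a, y)⟩ s = a := rfl
    have e0 : toTy p ⟨none, (a, y)⟩ 0 = a := rfl
    rw [e1] at h1
    rw [e0] at h0
    rw [← h1, ← h0]
  · -- primitive / E
    change ZMod p at y
    exfalso
    apply (((a, -y) : ZMod 2 × ZMod p) +ᵥ Quotient.out ω).2
    intro s
    have h1 := congrFun h s
    have h0 := congrFun h 0
    rw [toTy_some] at h1 h0
    have e1 : toTy p ⟨none, (a', y')⟩ s = a' := rfl
    have e0 : toTy p ⟨none, (a', y')⟩ 0 = a' := rfl
    rw [e1] at h1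
    rw [e0] at h0
    rw [h1, h0]
  · -- primitive / primitive
    change ZMod p at y; change ZMod p at y'
    rw [toTy_some, toTy_some] at h
    have h' : ((a, -y) : ZMod 2 × ZMod p) +ᵥ Quotient.out ω = ((a', -y') : ZMod 2 × ZMod p) +ᵥ Quotient.out ω' :=
      Subtype.ext h
    -- same orbit
    have hω : ω = ω' := by
      rw [← Quotient.out_eq ω, ← Quotient.out_eq ω']
      refine Quotient.sound (AddAction.orbitRel_apply.mpr (AddAction.mem_orbit_iff.mpr
        ⟨-((a, -y) : ZMod 2 × ZMod p) + (a', -y'), ?_⟩))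
      rw [add_vadd, ← h', neg_vadd_vadd]
    subst hω
    -- freeness
    have hfix : (-((a', -y') : ZMod 2 × ZMod p) + (a, -y)) +ᵥ Quotient.out ω = Quotient.out ω := by
      rw [add_vadd, h', neg_vadd_vadd]
    have h0 := (OddDegreeParityLaw.vadd_eq_self_iff p hp2 _ _).mp hfix
    have hab : ((a', -y') : ZMod 2 × ZMod p) = (a, -y) := neg_add_eq_zero.mp h0
    obtain ⟨ha, hy⟩ := Prod.ext_iff.mp hab
    simp only at ha hy
    have hy' : y' = y := neg_injective hy
    subst ha; subst hy'
    rfl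

/-- **The type map is surjective**: every type is constant or a twist of the representative of its orbit. [folklore] -/
theorem toTy_surjective : Function.Surjective (toTy p) := by
  intro ψ
  by_cases hc : ∀ y, ψ y = ψ 0
  · refine ⟨⟨none, (ψ 0, PUnit.unit)⟩, ?_⟩
    funext s
    exact (hc s).symm
  · set φ : Nonconst (ZMod p) := ⟨ψ, hc⟩ with hφ
    set ω : Orbits p := Quotient.mk _ φ with hω
    have hrel : (AddAction.orbitRel (ZMod 2 × ZMod p) (Nonconst (ZMod p))) (Quotient.out ω) φ := Quotient.mk_out φ
    obtain ⟨g, hg⟩ := AddAction.mem_orbit_iff.mp (AddAction.orbitRel_apply.mp hrel)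
    refine ⟨⟨some ω, ((-g).1, g.2)⟩, ?_⟩
    rw [toTy_some]
    have : (((-g).1, -g.2) : ZMod 2 × ZMod p) = -g := rfl
    rw [this, ← hg, neg_vadd_vadd]

/-- **The bijection «label ↦ type»** between b17's labels and the representative-free labels. [folklore] -/
noncomputable def toTyEquiv (hp2 : p ≠ 2) : Pt (AbO p) ≃ Ty p :=
  Equiv.ofBijective (toTy p) ⟨toTy_injective p hp2, toTy_surjective p⟩

/-- `toTyEquiv` is `toTy`. [folklore] -/
@[simp] theorem toTyEquiv_apply (hp2 : p ≠ 2) (x : Pt (AbO p)) : toTyEquiv p hp2 x = toTy p x := rfl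

/-! ## §2 Transport of exponent vectors: Hodge lattice, pairs, translates -/

/-- Pull-back of exponent vectors along the bijection: `(pull v)(x) = v (type of x)`. [folklore] -/
noncomputable def pull (hp2 : p ≠ 2) : (Ty p → ℤ) ≃ₗ[ℤ] (Pt (AbO p) → ℤ) :=
  LinearEquiv.funCongrLeft ℤ ℤ (toTyEquiv p hp2)

/-- `pull v x = v (toTy x)`. [folklore] -/
theorem pull_apply (hp2 : p ≠ 2) (v : Ty p → ℤ) (x : Pt (AbO p)) : pull p hp2 v x = v (toTy p x) := rfl

/-- The inverse transport: `(pull.symm m) (toTy x) = m x`. [folklore] -/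
theorem pull_symm_apply (hp2 : p ≠ 2) (m : Pt (AbO p) → ℤ) (x : Pt (AbO p)) : (pull p hp2).symm m (toTy p x) = m x := by
  have h := pull_apply p hp2 ((pull p hp2).symm m) x
  rw [LinearEquiv.apply_symm_apply] at h
  exact h.symm

/-- **The Hodge lattices correspond**: `m` is a Hodge vector of b17's model iff its push-forward is one of the representative-free
model. [folklore] -/
theorem mem_hodgeLattice_iff (hp2 : p ≠ 2) (m : Pt (AbO p) → ℤ) :
    m ∈ hodgeLattice (πO p) (φO p) ↔ (pull p hp2).symm m ∈ hodge p := by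
  have hform : ∀ g : ZMod 2 × ZMod p, coef p g ⬝ᵥ (pull p hp2).symm m = hodgeVec (πO p) (φO p) g ⬝ᵥ m := by
    intro g
    have h1 : (pull p hp2).symm m = m ∘ (toTyEquiv p hp2).symm := by
      funext ψ
      have := pull_symm_apply p hp2 m ((toTyEquiv p hp2).symm ψ)
      rw [← toTyEquiv_apply p hp2, Equiv.apply_symm_apply] at this
      exact this
    rw [h1, dotProduct_comp_equiv_symm]
    congr 1
    funext x
    exact (hodgeVec_eq_coef p g x).symm
  constructor
  · intro h g; rw [hform]; exact h g
  · intro h g; rw [← hform]; exact h g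

/-- Pull-back of a unit vector. [folklore] -/
theorem pull_single (hp2 : p ≠ 2) (ψ : Ty p) (c : ℤ) :
    pull p hp2 (Pi.single ψ c) = Pi.single ((toTyEquiv p hp2).symm ψ) c := by
  funext x
  rw [pull_apply, Pi.single_apply, Pi.single_apply]
  have hiff : toTy p x = ψ ↔ x = (toTyEquiv p hp2).symm ψ := by
    rw [← toTyEquiv_apply p hp2, Equiv.eq_symm_apply]
  simp only [hiff]

/-- **Pairs correspond**: the pull-back of a pair is a pair. [folklore] -/
theorem pull_pairVec (hp2 : p ≠ 2) (ψ : Ty p) :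
    pull p hp2 (pairVec p ψ) = OddDegreeParityLaw.pairVec ((toTyEquiv p hp2).symm ψ) := by
  unfold pairVec OddDegreeParityLaw.pairVec
  rw [map_add, pull_single, pull_single]
  congr 2
  apply (toTyEquiv p hp2).injective
  rw [Equiv.apply_symm_apply, toTyEquiv_apply, toTy_conj, ← toTyEquiv_apply p hp2, Equiv.apply_symm_apply]

/-- **Translates correspond**: the pull-back of a Galois translate is the Galois translate of the pull-back. [folklore] -/
theorem pull_transl (hp2 : p ≠ 2) (g : ZMod 2 × ZMod p) (v : Ty p → ℤ) :
    pull p hp2 (transl p g v) = OddDegreeParityLaw.transl (πO p) g (pull p hp2 v) := by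
  funext x
  show v (tw p (-g) (toTy p x)) = v (toTy p (act (πO p) (-g) x))
  rw [toTy_act]

/-! ## §3 The theorem of record -/

/-- **The class of the rank-four face `(φ; i, j)` in b17's model** of the full slice of `(ℤ/2p, p)`: the indicator of the four
labels whose types are the corners `φ, φ̄^{(i)} = φ + 1 + δ i, φ̄^{(j)}, φ^{(ij)} = φ + δ i + δ j` — the exponent vector of the
`1`-eigencomponent of the Weil line of the face (dictionary of part II; `faceClassO_apply`). [folklore] -/
noncomputable def faceClassO (φ : Ty p) (i j : ZMod p) : Pt (AbO p) → ℤ := fun x => faceVec p φ i j (toTy p x)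

/-- The face class is the indicator of the four labels carrying the four corner types. [folklore] -/
theorem faceClassO_apply (φ : Ty p) (i j : ZMod p) (x : Pt (AbO p)) : faceClassO p φ i j x =
    (if toTy p x = φ then 1 else 0) + (if toTy p x = φ + 1 + δ p i then 1 else 0) +
      (if toTy p x = φ + 1 + δ p j then 1 else 0) + (if toTy p x = φ + δ p i + δ p j then 1 else 0) :=
  faceVec_apply p φ i j (toTy p x)

/-- The pull-back of a face class of the representative-free model is the face class in b17's model. [folklore] -/
theorem pull_faceVec (hp2 : p ≠ 2) (φ : Ty p) (i j : ZMod p) : pull p hp2 (faceVec p φ i j) = faceClassO p φ i j := rfl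

/-- The transported family: the pull-backs of the classes of the canonical squares and of the closing face. [folklore] -/
noncomputable def familyO (hp2 : p ≠ 2) : Finset (Pt (AbO p) → ℤ) :=
  (family p).image fun f => pull p hp2 (faceVec p f.1 f.2.1 f.2.2)

/-- **The transported family generates**: b17's Hodge lattice of the full slice of `(ℤ/2p, p)` lies in the pairs plus the span of
the Galois translates of the transported face classes. [folklore] -/
theorem hodgeLattice_le_familyO (hp2 : p ≠ 2) :
    hodgeLattice (πO p) (φO p) ≤ OddDegreeParityLaw.pairs ⊔
      Submodule.span ℤ {v | ∃ g : ZMod 2 × ZMod p, ∃ t ∈ familyO p hp2, v = OddDegreeParityLaw.transl (πO p) g t} := by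
  intro m hm
  set W := Submodule.span ℤ {v | ∃ g : ZMod 2 × ZMod p, ∃ t ∈ familyO p hp2, v = OddDegreeParityLaw.transl (πO p) g t}
    with hW
  have hX : (pull p hp2).symm m ∈ pairs p ⊔ spanFaces p (family p) :=
    hodge_le_pairs_sup_spanFaces_family p hp2 ((mem_hodgeLattice_iff p hp2 m).mp hm)
  -- pull back: the images of the two pieces
  have hP : (pairs p).map (pull p hp2).toLinearMap ≤ OddDegreeParityLaw.pairs := by
    rw [Submodule.map_le_iff_le_comap]
    refine Submodule.span_le.mpr ?_
    rintro _ ⟨ψ, rfl⟩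
    simp only [SetLike.mem_coe, Submodule.mem_comap, LinearEquiv.coe_coe, pull_pairVec]
    exact Submodule.subset_span ⟨_, rfl⟩
  have hF : (spanFaces p (family p)).map (pull p hp2).toLinearMap ≤ W := by
    rw [Submodule.map_le_iff_le_comap]
    refine Submodule.span_le.mpr ?_
    rintro _ ⟨g, f, hf, rfl⟩
    simp only [SetLike.mem_coe, Submodule.mem_comap, LinearEquiv.coe_coe, pull_transl]
    exact Submodule.subset_span ⟨g, _, Finset.mem_image_of_mem _ hf, rfl⟩
  have hm' : m = pull p hp2 ((pull p hp2).symm m) := ((pull p hp2).apply_symm_apply m).symm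
  rw [hm']
  obtain ⟨a, ha, b, hb, hab⟩ := Submodule.mem_sup.mp hX
  rw [← hab, map_add]
  exact Submodule.add_mem _ (Submodule.mem_sup_left (hP ⟨a, ha, rfl⟩)) (Submodule.mem_sup_right (hF ⟨b, hb, rfl⟩))

/-- **THE THEOREM OF RECORD (faces suffice, all odd primes).**  In b17's model of the full slice of the Galois CM type `(ℤ/2p, p)`,
`p` an odd prime, there is a family `S` of exactly `(2^p − 2)/(2p) = (2^{p−1} − 1)/p` FACE CLASSES whose Galois translates generate
the Hodge lattice together with the divisor classes. [folklore] -/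
theorem cyclicPrime_faces (hp2 : p ≠ 2) :
    ∃ S : Finset (Pt (AbO p) → ℤ), S.card = (2 ^ p - 2) / (2 * p) ∧
      (∀ t ∈ S, ∃ (φ : Ty p) (i j : ZMod p), i ≠ j ∧ t = faceClassO p φ i j) ∧
      hodgeLattice (πO p) (φO p) ≤ OddDegreeParityLaw.pairs ⊔
        Submodule.span ℤ {v | ∃ g : ZMod 2 × ZMod p, ∃ t ∈ S, v = OddDegreeParityLaw.transl (πO p) g t} := by
  refine ⟨familyO p hp2, le_antisymm ?_ ?_, ?_, hodgeLattice_le_familyO p hp2⟩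
  · calc (familyO p hp2).card ≤ (family p).card := Finset.card_image_le
      _ = (2 ^ p - 2) / (2 * p) := family_card_eq p hp2
  · exact OddDegreeParityLaw.cyclicPrime_law p hp2 _ (hodgeLattice_le_familyO p hp2)
  · intro t ht
    obtain ⟨f, hf, rfl⟩ := Finset.mem_image.mp ht
    exact ⟨f.1, f.2.1, f.2.2, family_places p hp2 hf, pull_faceVec p hp2 _ _ _⟩

/-- **`μ(ℤ/2p) = (2^{p−1} − 1)/p`, ATTAINED BY FACES** (b17's `cyclicPrime_law` is an equality): the least number of Galois orbits
of integer vectors generating the Hodge lattice of the full slice of `(ℤ/2p, p)` modulo divisor classes is `(2^p − 2)/(2p)`, and a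
family of that many rank-four face classes achieves it — `1, 3, 9, 93, 315, 3855, 13797, …` for `2p = 6, 10, 14, 22, 26, 34, 38, …`.
[folklore] -/
theorem cyclicPrime_law_eq (hp2 : p ≠ 2) :
    (∃ S : Finset (Pt (AbO p) → ℤ), S.card = (2 ^ p - 2) / (2 * p) ∧
      (∀ t ∈ S, ∃ (φ : Ty p) (i j : ZMod p), i ≠ j ∧ t = faceClassO p φ i j) ∧
      hodgeLattice (πO p) (φO p) ≤ OddDegreeParityLaw.pairs ⊔
        Submodule.span ℤ {v | ∃ g : ZMod 2 × ZMod p, ∃ t ∈ S, v = OddDegreeParityLaw.transl (πO p) g t}) ∧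
    (∀ S : Finset (Pt (AbO p) → ℤ), hodgeLattice (πO p) (φO p) ≤ OddDegreeParityLaw.pairs ⊔
        Submodule.span ℤ {v | ∃ g : ZMod 2 × ZMod p, ∃ t ∈ S, v = OddDegreeParityLaw.transl (πO p) g t} →
      (2 ^ p - 2) / (2 * p) ≤ S.card) :=
  ⟨cyclicPrime_faces p hp2, fun S hS => OddDegreeParityLaw.cyclicPrime_law p hp2 S hS⟩

end Summit.HodgeConjecture.CorCM.Census.CyclicPrimeFacesSlice
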